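import Summits.QuantumFields.YangMills.Theorems.BalabanUVNodesN11TStepBranchSumOldIndex

/-!
# DAG node N11 — (O3′) ON THE NOSE FROM THE LEVEL-`k` §2 FORM AT `init s′` AND PER-OLD-BRANCH INNER READINGS ∕ CHARTED IDENTIFICATIONS (the assembly over the old-index
# bookkeeping)

HEADER — WORK-UNIT METADATA.  Cell `pub-ymgap`, YM-PLAN Track A (HUMAN RULING D-0062), seat `pub-ymgap-dag-n11-d` (g15; R134 fan-out base seat N11 [B14], strategy s2),
route `BalabanUVNodes` rev 27, item K1⁸ `StabilityBRunRowsAtRecordR13SepCoPH` = stmt-QuantumFields-26907 (helper lane, `--kind proof --supports 26907 --as helper`,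
count-neutral).  [III] = [Balaban1988Convergent].  Sequel (split for the 400-line rule; CLAIM-2 of g15) of `…N11TStepBranchSumOldIndex` (§1 `sum_admSOfRecord_succ`, §2
`tkBranchOfRecord_update_succ_eq_init`, §3 `kernelTransport_finset_sum_ae`), of dag-n11-w2's `…N11KernelTransportSkewProduct` (`kernelTransport_congr_ae`) and of `…N11TStepBranchSum` (p619836 ★★★★★★ `slotsTOfRecord_succ_ae_eq_TkOfRecord_succ_of_innerSum`), with
dag-n11-e's `…N11AveragingSkewPresentationAtRecord` ∕ `Node00/AveragingSkewPresentation` (`map_prod_avOfRecord_glue_skew_absolutelyContinuous_Omega`, `measurable_avOfRecord_glue_skew`,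
`measurePreserving_piEquivPiSubtypeProd_symm_fieldMeasure`) BY NAME.

WHY THIS FILE.  p619836 closes (O3′) modulo ONE summed inner identification `hinnerSum` over the whole `{S_j}`-index at length `k+1` for ONE inner reading of the graph integrand.
[III] §3 works PER OLD BRANCH: Theorem 1's inductive hypothesis at `init s′` splits the old slot over the old index on the `χ_k`-support, the chart acts on each old-branch piece,
and the new branches above `S₀` are `S₀ ∪ {S_{k+1} = Y}`.  THIS FILE assembles: (O3′) on the nose from the level-`k` form (form), per-old-branch graph integrability (hG₀),
per-old-branch inner readings (hin₀), the conditional integrability row (hint) and THE PER-OLD-BRANCH CHARTED IDENTIFICATIONS (hinner₀) — the last being where [I] §2's change of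
variables, its Jacobian, the gauge fixing (dag-n11-e p618524 ∕ p620090), `ζ`, `aOp` AND [III] Thm 2's re-expansion of the new small-field integral live; DISPLAYED, not proved.

WHAT THIS FILE PROVES (0 `def`, 0 `sorry`, standard axioms; generic letters — the Stage-13 editions are the sequel `…N11TStepOldBranchInnerSumAtRecord13`).
`graph_ae_eq_sum_oldBranch_pieces` (the graph integrand = Σ old-branch pieces, `dU`-a.e.) · ★ `innerReading_of_oldBranch_pieces` (p616225's `hin` for the whole graph integrand
with `Fᵢ := Σ_{S₀} Fᵢ₀ S₀` from per-old-branch `hin₀`) · ★ `innerSum_of_oldBranch_identifications` (p619836's `hinnerSum` from per-old-branch `hinner₀`) · ★★★★★★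
`slotsTOfRecord_succ_ae_eq_TkOfRecord_succ_of_oldBranchInnerSum` ((O3′)'s identity on the nose from (form) + `hG₀` + `hin₀` + `hint` + `hinner₀`).

HONEST FRAMING.  Helper lane of K1⁸; count-neutral; composition BY NAME (pointwise splitting of the graph integrand by `TkOfRecord_apply`, a.e. additivity of the skew transport,
index bijection); every inner reading ∕ charted identification ∕ integrability row DISPLAYED; NO chart of Bałaban's, NO Jacobian, NO Gaussian integration, nothing of [I] §2 ∕
[III] §3 ∕ Thm 2 asserted; (B4) ∕ (S-α) ∕ (O3′) NOT closed; N11 NOT discharged; K1⁸ NOT closed, no registered stub touched; counts unmoved (typed 28∕28 · discharged 5∕27 · A 5∕28).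
One finite `𝕋⁴_{L^K}` programme at fixed `ε = L^{−K}`; R4 closes only the conditional finite-𝕋⁴ rung `BalabanLadder.UV` — NOT ℝ⁴, NOT OS, NOT a mass gap, NOT Clay.  No `sorry`,
`axiom`, `def`, `instance`, `notation`.  Sources (SHAPE ∕ bookkeeping only): [III] (2.1) p.254, (2.18) p.257, (2.20)–(2.21) p.258, (3.1) p.264, (3.24)–(3.25) p.270, §3 p.279.
-/

noncomputable section

open MeasureTheory ProbabilityTheory
open scoped ENNReal NNReal BigOperators Matrix.Norms.L2Operator

namespace Summit.QuantumFields.YangMills.Theorems.BalabanUVNodesN11TStepOldBranchInnerSum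

open Literature.MathematicalPhysics.QuantumFieldTheory.Balaban1983to89
open Literature.MathematicalPhysics.QuantumFieldTheory.Balaban1983to89.T4AveragingDisintegration
open BalabanUVNodesN11TStepBranchSum (slotsTOfRecord_succ_ae_eq_TkOfRecord_succ_of_innerSum)
open BalabanUVNodesN11TStepBranchSumOldIndex (sum_admSOfRecord_succ tkBranchOfRecord_update_succ_eq_init kernelTransport_finset_sum_ae)
open BalabanUVNodesN11KernelTransportSkewProduct (kernelTransport_congr_ae)
open BalabanUVNodesN11AveragingSkewPresentationAtRecord (map_prod_avOfRecord_glue_skew_absolutelyContinuous_Omega)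
open Node00 hiding SU
open Node00.Tk T4Continuum B14.Eq218Concrete
open B10Eq42TorusConstraint (bondsIn)

section OldBranch

variable {F : T4Family} {N : ℕ} [NeZero N]
variable {V : Type} [NormedAddCommGroup V] [InnerProductSpace ℝ V] [FiniteDimensional ℝ V] [MeasurableSpace V] [BorelSpace V]

/-- **THE GRAPH INTEGRAND IS THE SUM OF THE OLD-BRANCH PIECES, `dU`-a.e.**: from the level-`k` form at `init s′` (a.e. on the `χ_k`-support) and `TkOfRecord_apply`;
off the support both sides vanish. [cite: Balaban1988Convergent, (2.17)–(2.18) p.257, (3.1) p.264] -/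
theorem graph_ae_eq_sum_oldBranch_pieces (ν : Stage7Numerics) (τ : TowerNumerics) (E : B12.RunParams → ℝ)
    (w : StepWeightsOfRecord F N ν τ.M) (ppSel : PpSelOfRecord F ν τ.M) (p : B12.RunParams) (g : ℕ → ℝ) {k : ℕ}
    (s' : SeqOfRecord F ν τ.M g p.K (k + 1)) (W₀ : TkWeights F N V p.K) (Φ₀ : SFluct (F.P p.K) V → B15DeterminingSets.MSField (F.P p.K) (SU N) → ℝ)
    (hform : ∀ᵐ U ∂fieldMeasure (F.P p.K) k (SU N), chiSeqOfRecord F N ν τ.M g p.K k s'.init U ≠ 0 →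
      slotsOfRecord F N ν τ E w ppSel p g k s'.init U = TkOfRecord F N V ν τ.M g p.K W₀ k s'.init Φ₀ U) :
    (fun U => w p g k s' U ((avOfRecord F N p.K k).avg U) *
        (chiSeqOfRecord F N ν τ.M g p.K k s'.init U * slotsOfRecord F N ν τ E w ppSel p g k s'.init U)) =ᵐ[fieldMeasure (F.P p.K) k (SU N)]
      fun U => ∑ S₀ ∈ admSOfRecord F ν τ.M g p.K k s'.init, w p g k s' U ((avOfRecord F N p.K k).avg U) *
        (chiSeqOfRecord F N ν τ.M g p.K k s'.init U *
          tkBranchOfRecord F N V ν τ.M g p.K W₀ s'.init S₀ k (fun ω => Φ₀ (S₀, fun j => (ω j).2) (fun j => (ω j).1)) (baseCfg k U)) := by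
  filter_upwards [hform] with U hU
  by_cases hχ : chiSeqOfRecord F N ν τ.M g p.K k s'.init U = 0
  · simp only [hχ, zero_mul, mul_zero, Finset.sum_const_zero]
  · rw [hU hχ, TkOfRecord_apply, Finset.mul_sum, Finset.mul_sum]

/-- ★ **THE INNER READING OF THE GRAPH INTEGRAND IS THE SUM OF THE PER-OLD-BRANCH INNER READINGS** (`k < K` through `hk`): from the level-`k` form, per-old-branch graph
integrability `hG₀` and per-old-branch inner readings `hin₀`, p616225's `hin` holds for the whole graph integrand with `Fᵢ := Σ_{S₀} Fᵢ₀ S₀` — §3 of `…BranchSumOldIndex` (a.e.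
additivity by uniqueness), dag-n11-w2's `kernelTransport_congr_ae`, dag-n11-e's skew a.c. ∕ measurability ∕ measure preservation of the glue.
[cite: Balaban1988Convergent, (3.1) p.264, (2.18) p.257 (bookkeeping)] -/
theorem innerReading_of_oldBranch_pieces (ν : Stage7Numerics) (τ : TowerNumerics) (E : B12.RunParams → ℝ)
    (w : StepWeightsOfRecord F N ν τ.M) (ppSel : PpSelOfRecord F ν τ.M) (p : B12.RunParams) (g : ℕ → ℝ) {k : ℕ}
    {hdec : DecidableEq (PBond (F.P p.K) k)} {hdec' : DecidableEq (PBond (F.P p.K) (k + 1))} (hk : k + 1 ≤ (F.P p.K).m + (F.P p.K).K)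
    (s' : SeqOfRecord F ν τ.M g p.K (k + 1)) (W₀ : TkWeights F N V p.K) (Φ₀ : SFluct (F.P p.K) V → B15DeterminingSets.MSField (F.P p.K) (SU N) → ℝ)
    (hform : ∀ᵐ U ∂fieldMeasure (F.P p.K) k (SU N), chiSeqOfRecord F N ν τ.M g p.K k s'.init U ≠ 0 →
      slotsOfRecord F N ν τ E w ppSel p g k s'.init U = TkOfRecord F N V ν τ.M g p.K W₀ k s'.init Φ₀ U)
    (hG₀ : ∀ S₀ ∈ admSOfRecord F ν τ.M g p.K k s'.init, Integrable (fun U => w p g k s' U ((avOfRecord F N p.K k).avg U) *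
        (chiSeqOfRecord F N ν τ.M g p.K k s'.init U *
          tkBranchOfRecord F N V ν τ.M g p.K W₀ s'.init S₀ k (fun ω => Φ₀ (S₀, fun j => (ω j).2) (fun j => (ω j).1)) (baseCfg k U)))
      (fieldMeasure (F.P p.K) k (SU N)))
    (Fᵢ₀ : (ℕ → Set (Site (F.P p.K) 0)) → (↥(Set.toFinite (bondsIn k (s'.Ω (k + 1))ᶜ)).toFinset → SU N) ×
        ({c : PBond (F.P p.K) (k + 1) // c ∉ (Set.toFinite (bondsIn (k + 1) (s'.Ω (k + 1))ᶜ)).toFinset} → SU N) → ℝ)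
    (hin₀ : ∀ S₀ ∈ admSOfRecord F ν τ.M g p.K k s'.init, kernelTransport
        ((Measure.pi fun _ : ↥(Set.toFinite (bondsIn k (s'.Ω (k + 1))ᶜ)).toFinset => (HaarData.haar : Measure (SU N))).prod
          (Measure.pi fun _ : {b : PBond (F.P p.K) k // b ∉ (Set.toFinite (bondsIn k (s'.Ω (k + 1))ᶜ)).toFinset} => (HaarData.haar : Measure (SU N))))
        ((Measure.pi fun _ : ↥(Set.toFinite (bondsIn k (s'.Ω (k + 1))ᶜ)).toFinset => (HaarData.haar : Measure (SU N))).prod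
          (Measure.pi fun _ : {c : PBond (F.P p.K) (k + 1) // c ∉ (Set.toFinite (bondsIn (k + 1) (s'.Ω (k + 1))ᶜ)).toFinset} =>
            (HaarData.haar : Measure (SU N))))
        (fun q => (q.1, fun c : {c : PBond (F.P p.K) (k + 1) // c ∉ (Set.toFinite (bondsIn (k + 1) (s'.Ω (k + 1))ᶜ)).toFinset} =>
          (avOfRecord F N p.K k).avg
            ((MeasurableEquiv.piEquivPiSubtypeProd (fun _ : PBond (F.P p.K) k => SU N)
              (· ∈ (Set.toFinite (bondsIn k (s'.Ω (k + 1))ᶜ)).toFinset)).symm q) c))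
        ((fun U => w p g k s' U ((avOfRecord F N p.K k).avg U) *
        (chiSeqOfRecord F N ν τ.M g p.K k s'.init U *
          tkBranchOfRecord F N V ν τ.M g p.K W₀ s'.init S₀ k (fun ω => Φ₀ (S₀, fun j => (ω j).2) (fun j => (ω j).1)) (baseCfg k U))) ∘
          ⇑(MeasurableEquiv.piEquivPiSubtypeProd (fun _ : PBond (F.P p.K) k => SU N)
            (· ∈ (Set.toFinite (bondsIn k (s'.Ω (k + 1))ᶜ)).toFinset)).symm)
      =ᵐ[((Measure.pi fun _ : ↥(Set.toFinite (bondsIn k (s'.Ω (k + 1))ᶜ)).toFinset => (HaarData.haar : Measure (SU N))).prod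
          (Measure.pi fun _ : {c : PBond (F.P p.K) (k + 1) // c ∉ (Set.toFinite (bondsIn (k + 1) (s'.Ω (k + 1))ᶜ)).toFinset} =>
            (HaarData.haar : Measure (SU N))))] Fᵢ₀ S₀) :
    kernelTransport
        ((Measure.pi fun _ : ↥(Set.toFinite (bondsIn k (s'.Ω (k + 1))ᶜ)).toFinset => (HaarData.haar : Measure (SU N))).prod
          (Measure.pi fun _ : {b : PBond (F.P p.K) k // b ∉ (Set.toFinite (bondsIn k (s'.Ω (k + 1))ᶜ)).toFinset} => (HaarData.haar : Measure (SU N))))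
        ((Measure.pi fun _ : ↥(Set.toFinite (bondsIn k (s'.Ω (k + 1))ᶜ)).toFinset => (HaarData.haar : Measure (SU N))).prod
          (Measure.pi fun _ : {c : PBond (F.P p.K) (k + 1) // c ∉ (Set.toFinite (bondsIn (k + 1) (s'.Ω (k + 1))ᶜ)).toFinset} =>
            (HaarData.haar : Measure (SU N))))
        (fun q => (q.1, fun c : {c : PBond (F.P p.K) (k + 1) // c ∉ (Set.toFinite (bondsIn (k + 1) (s'.Ω (k + 1))ᶜ)).toFinset} =>
          (avOfRecord F N p.K k).avg
            ((MeasurableEquiv.piEquivPiSubtypeProd (fun _ : PBond (F.P p.K) k => SU N)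
              (· ∈ (Set.toFinite (bondsIn k (s'.Ω (k + 1))ᶜ)).toFinset)).symm q) c))
        ((fun U => w p g k s' U ((avOfRecord F N p.K k).avg U) *
        (chiSeqOfRecord F N ν τ.M g p.K k s'.init U * slotsOfRecord F N ν τ E w ppSel p g k s'.init U)) ∘
          ⇑(MeasurableEquiv.piEquivPiSubtypeProd (fun _ : PBond (F.P p.K) k => SU N)
            (· ∈ (Set.toFinite (bondsIn k (s'.Ω (k + 1))ᶜ)).toFinset)).symm)
      =ᵐ[((Measure.pi fun _ : ↥(Set.toFinite (bondsIn k (s'.Ω (k + 1))ᶜ)).toFinset => (HaarData.haar : Measure (SU N))).prod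
          (Measure.pi fun _ : {c : PBond (F.P p.K) (k + 1) // c ∉ (Set.toFinite (bondsIn (k + 1) (s'.Ω (k + 1))ᶜ)).toFinset} =>
            (HaarData.haar : Measure (SU N))))] fun z => ∑ S₀ ∈ admSOfRecord F ν τ.M g p.K k s'.init, Fᵢ₀ S₀ z := by
  have hGae := graph_ae_eq_sum_oldBranch_pieces ν τ E w ppSel p g s' W₀ Φ₀ hform
  have hG : Integrable (fun U => w p g k s' U ((avOfRecord F N p.K k).avg U) *
        (chiSeqOfRecord F N ν τ.M g p.K k s'.init U * slotsOfRecord F N ν τ E w ppSel p g k s'.init U)) (fieldMeasure (F.P p.K) k (SU N)) :=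
    (integrable_finsetSum _ hG₀).congr hGae.symm
  have hpres := measurePreserving_piEquivPiSubtypeProd_symm_fieldMeasure (G := SU N) (Set.toFinite (bondsIn k (s'.Ω (k + 1))ᶜ)).toFinset
  have hadd := kernelTransport_finset_sum_ae
    ((Measure.pi fun _ : ↥(Set.toFinite (bondsIn k (s'.Ω (k + 1))ᶜ)).toFinset => (HaarData.haar : Measure (SU N))).prod
          (Measure.pi fun _ : {b : PBond (F.P p.K) k // b ∉ (Set.toFinite (bondsIn k (s'.Ω (k + 1))ᶜ)).toFinset} => (HaarData.haar : Measure (SU N))))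
    ((Measure.pi fun _ : ↥(Set.toFinite (bondsIn k (s'.Ω (k + 1))ᶜ)).toFinset => (HaarData.haar : Measure (SU N))).prod
          (Measure.pi fun _ : {c : PBond (F.P p.K) (k + 1) // c ∉ (Set.toFinite (bondsIn (k + 1) (s'.Ω (k + 1))ᶜ)).toFinset} =>
            (HaarData.haar : Measure (SU N))))
    (measurable_avOfRecord_glue_skew F N p.K k (Set.toFinite (bondsIn k (s'.Ω (k + 1))ᶜ)).toFinset (Set.toFinite (bondsIn (k + 1) (s'.Ω (k + 1))ᶜ)).toFinset)
    (map_prod_avOfRecord_glue_skew_absolutelyContinuous_Omega (F := F) (N := N) p.K s' k hk)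
    (admSOfRecord F ν τ.M g p.K k s'.init)
    (fun S₀ => (fun U => w p g k s' U ((avOfRecord F N p.K k).avg U) *
        (chiSeqOfRecord F N ν τ.M g p.K k s'.init U *
          tkBranchOfRecord F N V ν τ.M g p.K W₀ s'.init S₀ k (fun ω => Φ₀ (S₀, fun j => (ω j).2) (fun j => (ω j).1)) (baseCfg k U))) ∘
      ⇑(MeasurableEquiv.piEquivPiSubtypeProd (fun _ : PBond (F.P p.K) k => SU N)
            (· ∈ (Set.toFinite (bondsIn k (s'.Ω (k + 1))ᶜ)).toFinset)).symm)
    (fun S₀ h₀ => (hpres.integrable_comp (hG₀ S₀ h₀).aestronglyMeasurable).mpr (hG₀ S₀ h₀))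
  have hcomp : ((fun U => w p g k s' U ((avOfRecord F N p.K k).avg U) *
        (chiSeqOfRecord F N ν τ.M g p.K k s'.init U * slotsOfRecord F N ν τ E w ppSel p g k s'.init U)) ∘
          ⇑(MeasurableEquiv.piEquivPiSubtypeProd (fun _ : PBond (F.P p.K) k => SU N)
            (· ∈ (Set.toFinite (bondsIn k (s'.Ω (k + 1))ᶜ)).toFinset)).symm) =ᵐ[((Measure.pi fun _ : ↥(Set.toFinite (bondsIn k (s'.Ω (k + 1))ᶜ)).toFinset => (HaarData.haar : Measure (SU N))).prod
          (Measure.pi fun _ : {b : PBond (F.P p.K) k // b ∉ (Set.toFinite (bondsIn k (s'.Ω (k + 1))ᶜ)).toFinset} => (HaarData.haar : Measure (SU N))))]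
      fun x => ∑ S₀ ∈ admSOfRecord F ν τ.M g p.K k s'.init, ((fun U => w p g k s' U ((avOfRecord F N p.K k).avg U) *
        (chiSeqOfRecord F N ν τ.M g p.K k s'.init U *
          tkBranchOfRecord F N V ν τ.M g p.K W₀ s'.init S₀ k (fun ω => Φ₀ (S₀, fun j => (ω j).2) (fun j => (ω j).1)) (baseCfg k U))) ∘
      ⇑(MeasurableEquiv.piEquivPiSubtypeProd (fun _ : PBond (F.P p.K) k => SU N)
            (· ∈ (Set.toFinite (bondsIn k (s'.Ω (k + 1))ᶜ)).toFinset)).symm) x := by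
    filter_upwards [hpres.quasiMeasurePreserving.ae_eq_comp hGae] with x hx
    simpa only [Function.comp_apply, Finset.sum_apply] using hx
  have hcongr := kernelTransport_congr_ae
    ((Measure.pi fun _ : ↥(Set.toFinite (bondsIn k (s'.Ω (k + 1))ᶜ)).toFinset => (HaarData.haar : Measure (SU N))).prod
          (Measure.pi fun _ : {b : PBond (F.P p.K) k // b ∉ (Set.toFinite (bondsIn k (s'.Ω (k + 1))ᶜ)).toFinset} => (HaarData.haar : Measure (SU N))))
    ((Measure.pi fun _ : ↥(Set.toFinite (bondsIn k (s'.Ω (k + 1))ᶜ)).toFinset => (HaarData.haar : Measure (SU N))).prod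
          (Measure.pi fun _ : {c : PBond (F.P p.K) (k + 1) // c ∉ (Set.toFinite (bondsIn (k + 1) (s'.Ω (k + 1))ᶜ)).toFinset} =>
            (HaarData.haar : Measure (SU N))))
    (measurable_avOfRecord_glue_skew F N p.K k (Set.toFinite (bondsIn k (s'.Ω (k + 1))ᶜ)).toFinset (Set.toFinite (bondsIn (k + 1) (s'.Ω (k + 1))ᶜ)).toFinset)
    (map_prod_avOfRecord_glue_skew_absolutelyContinuous_Omega (F := F) (N := N) p.K s' k hk)
    ((hpres.integrable_comp hG.aestronglyMeasurable).mpr hG) hcomp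
  have hall := (Filter.eventually_all_finset (admSOfRecord F ν τ.M g p.K k s'.init)).2 hin₀
  filter_upwards [hcongr, hadd, hall] with z hz1 hz hallz
  exact hz1.trans (hz.trans (Finset.sum_congr rfl fun S₀ h₀ => hallz S₀ h₀))

/-- ★ **THE SUMMED INNER IDENTIFICATION OF p619836 FROM THE PER-OLD-BRANCH CHARTED IDENTIFICATIONS**: with `Fᵢ := Σ_{S₀} Fᵢ₀ S₀`, `hinnerSum` over `admSOfRecord (k+1) s′`
follows from `hinner₀` by §1's index bijection and §2's `𝐓_k(s′, S₀ ∪ Y) = 𝐓_k(init s′, S₀)` of `…BranchSumOldIndex`. [cite: Balaban1988Convergent, (2.1) p.254, (2.20)–(2.21) p.258 (bookkeeping)] -/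
theorem innerSum_of_oldBranch_identifications (ν : Stage7Numerics) (τ : TowerNumerics) (p : B12.RunParams) (g : ℕ → ℝ) {k : ℕ}
    {hdec : DecidableEq (PBond (F.P p.K) k)} {hdec' : DecidableEq (PBond (F.P p.K) (k + 1))}
    (s' : SeqOfRecord F ν τ.M g p.K (k + 1)) (W : TkWeights F N V p.K) (Φ : SFluct (F.P p.K) V → B15DeterminingSets.MSField (F.P p.K) (SU N) → ℝ)
    (Fᵢ₀ : (ℕ → Set (Site (F.P p.K) 0)) → (↥(Set.toFinite (bondsIn k (s'.Ω (k + 1))ᶜ)).toFinset → SU N) ×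
        ({c : PBond (F.P p.K) (k + 1) // c ∉ (Set.toFinite (bondsIn (k + 1) (s'.Ω (k + 1))ᶜ)).toFinset} → SU N) → ℝ)
    (hinner₀ : ∀ᵐ q ∂((Measure.pi fun _ : ↥(Set.toFinite (bondsIn (k + 1) (s'.Ω (k + 1))ᶜ)).toFinset => (HaarData.haar : Measure (SU N))).prod
          (Measure.pi fun _ : {c : PBond (F.P p.K) (k + 1) // c ∉ (Set.toFinite (bondsIn (k + 1) (s'.Ω (k + 1))ᶜ)).toFinset} =>
            (HaarData.haar : Measure (SU N)))),
      ∀ S₀ ∈ admSOfRecord F ν τ.M g p.K k s'.init, ∀ y : ↥(Set.toFinite (bondsIn k (s'.Ω (k + 1))ᶜ)).toFinset → SU N,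
        avgRestrOfRecord F N p.K k (Set.toFinite (bondsIn k (s'.Ω (k + 1))ᶜ)).toFinset (Set.toFinite (bondsIn (k + 1) (s'.Ω (k + 1))ᶜ)).toFinset y = q.1 →
        Fᵢ₀ S₀ (y, q.2) =
          ∑ Y ∈ (Set.toFinite {Y : Set (Site (F.P p.K) 0) | Y ∈ SClassOfRecord F ν g p.K (k + 1) ∧ Y ⊆ s'.Ω (k + 1) ∩ (s'.Λ (k + 1))ᶜ}).toFinset,
            zetaOp (genDataOfRecord F N V ν τ.M g p.K W s' (Function.update S₀ (k + 1) Y) k).ζ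
              (aOp k (genDataOfRecord F N V ν τ.M g p.K W s' (Function.update S₀ (k + 1) Y) k).sA
                (genDataOfRecord F N V ν τ.M g p.K W s' (Function.update S₀ (k + 1) Y) k).w
                (tkBranchOfRecord F N V ν τ.M g p.K W s'.init S₀ k
                  (fun ω => Φ (Function.update S₀ (k + 1) Y, fun j => (ω j).2) (fun j => (ω j).1))))
              (Function.update (baseCfg (k + 1) ((MeasurableEquiv.piEquivPiSubtypeProd (fun _ : PBond (F.P p.K) (k + 1) => SU N)
                (· ∈ (Set.toFinite (bondsIn (k + 1) (s'.Ω (k + 1))ᶜ)).toFinset)).symm q)) k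
              (Function.updateFinset ((baseCfg (V := V) (k + 1) ((MeasurableEquiv.piEquivPiSubtypeProd (fun _ : PBond (F.P p.K) (k + 1) => SU N)
                (· ∈ (Set.toFinite (bondsIn (k + 1) (s'.Ω (k + 1))ᶜ)).toFinset)).symm q)) k).1 (Set.toFinite (bondsIn k (s'.Ω (k + 1))ᶜ)).toFinset y,
                ((baseCfg (V := V) (k + 1) ((MeasurableEquiv.piEquivPiSubtypeProd (fun _ : PBond (F.P p.K) (k + 1) => SU N)
                (· ∈ (Set.toFinite (bondsIn (k + 1) (s'.Ω (k + 1))ᶜ)).toFinset)).symm q)) k).2))) :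
    ∀ᵐ q ∂((Measure.pi fun _ : ↥(Set.toFinite (bondsIn (k + 1) (s'.Ω (k + 1))ᶜ)).toFinset => (HaarData.haar : Measure (SU N))).prod
          (Measure.pi fun _ : {c : PBond (F.P p.K) (k + 1) // c ∉ (Set.toFinite (bondsIn (k + 1) (s'.Ω (k + 1))ᶜ)).toFinset} =>
            (HaarData.haar : Measure (SU N)))),
      ∀ y : ↥(Set.toFinite (bondsIn k (s'.Ω (k + 1))ᶜ)).toFinset → SU N,
        avgRestrOfRecord F N p.K k (Set.toFinite (bondsIn k (s'.Ω (k + 1))ᶜ)).toFinset (Set.toFinite (bondsIn (k + 1) (s'.Ω (k + 1))ᶜ)).toFinset y = q.1 →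
        (fun z => ∑ S₀ ∈ admSOfRecord F ν τ.M g p.K k s'.init, Fᵢ₀ S₀ z) (y, q.2) =
          ∑ S ∈ admSOfRecord F ν τ.M g p.K (k + 1) s', zetaOp (genDataOfRecord F N V ν τ.M g p.K W s' S k).ζ
            (aOp k (genDataOfRecord F N V ν τ.M g p.K W s' S k).sA (genDataOfRecord F N V ν τ.M g p.K W s' S k).w
              (tkBranchOfRecord F N V ν τ.M g p.K W s' S k (fun ω => Φ (S, fun j => (ω j).2) (fun j => (ω j).1))))
            (Function.update (baseCfg (k + 1) ((MeasurableEquiv.piEquivPiSubtypeProd (fun _ : PBond (F.P p.K) (k + 1) => SU N)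
                (· ∈ (Set.toFinite (bondsIn (k + 1) (s'.Ω (k + 1))ᶜ)).toFinset)).symm q)) k
              (Function.updateFinset ((baseCfg (V := V) (k + 1) ((MeasurableEquiv.piEquivPiSubtypeProd (fun _ : PBond (F.P p.K) (k + 1) => SU N)
                (· ∈ (Set.toFinite (bondsIn (k + 1) (s'.Ω (k + 1))ᶜ)).toFinset)).symm q)) k).1 (Set.toFinite (bondsIn k (s'.Ω (k + 1))ᶜ)).toFinset y,
                ((baseCfg (V := V) (k + 1) ((MeasurableEquiv.piEquivPiSubtypeProd (fun _ : PBond (F.P p.K) (k + 1) => SU N)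
                (· ∈ (Set.toFinite (bondsIn (k + 1) (s'.Ω (k + 1))ᶜ)).toFinset)).symm q)) k).2)) := by
  filter_upwards [hinner₀] with q hq y hy
  rw [sum_admSOfRecord_succ F s']
  refine Finset.sum_congr rfl fun S₀ h₀ => ?_
  rw [hq S₀ h₀ y hy]
  refine Finset.sum_congr rfl fun Y _ => ?_
  rw [tkBranchOfRecord_update_succ_eq_init ν τ.M g p.K W s' S₀ Y]

/-- ★★★★★★ **(O3′) ON THE NOSE FROM THE OLD-BRANCH DATA.**  At step `k < K` of the run `p`, history `s′` of length `k+1`, NEW weights `W` and NEW operand `Φ`: from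
(form) the level-`k` §2 form at `init s′` — `dU`-a.e. on the `χ_k`-support the old slot IS `𝐓_k(init s′)[W₀]Φ₀` for some old `(W₀, Φ₀)` (Theorem 1's inductive hypothesis
`HasSect2FormAtZS`'s a.e. clause, through `sect2Slot = TkOfRecord ∘ sect2Operand`; its `slot = 0` disjunct is (O3′)'s left disjunct by dag-n11-e's `slotsTOfRecord₁₃H_succ_eq_zero_of_init_eq_zero`);
(hG₀) `dU`-integrability of each old-branch graph piece `G_{S₀} = w(s′)(·,Ū)·χ_k(init s′)·(𝐓_k(init s′,S₀)Φ₀_{S₀})(base_k ·)`; (hin₀) a measurable inner reading `Fᵢ₀ S₀` of each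
piece (p616225's `hin`, per piece); (hint) p619836's row; (hinner₀) THE PER-OLD-BRANCH CHARTED IDENTIFICATION — on the averaging fibre, `Fᵢ₀ S₀ (y, q.2)` IS the sum over the
admissible NEW regions `Y` of `ζ_k(ω_y)·(aOp k sA w_{S₀,Y} (𝐓_k(init s′, S₀) Φ_{S₀ ∪ Y}))(ω_y)` (§2b turns it into ONE A-integral) — conclude
`slotsTOfRecord … (k+1) s′ =ᵐ[dV′] TkOfRecord … W (k+1) s′ Φ`.  Proof: graph integrand `= Σ_{S₀} G_{S₀}` pointwise (form + `TkOfRecord_apply`); inner reading of the sum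
`= Σ_{S₀} Fᵢ₀ S₀` (§3 + dag-n11-e's `map_prod_avOfRecord_glue_skew_absolutelyContinuous_Omega` ∕ `measurable_avOfRecord_glue_skew` ∕ `measurePreserving_piEquivPiSubtypeProd_symm_fieldMeasure`);
p619836's `hinnerSum` from `hinner₀` by §1 + §2; then p619836 ★★★★★★.  `hinner₀` is where [I] §2 ∕ [III] §3 ∕ Thm 2 live — DISPLAYED, not proved.
[cite: Balaban1988Convergent, (2.1) p.254, (2.18) p.257, (2.20)–(2.21) p.258, (3.1) p.264, (3.24)–(3.25) p.270, §3 p.279, Thm 1 p.262, Thm 2 p.263] -/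
theorem slotsTOfRecord_succ_ae_eq_TkOfRecord_succ_of_oldBranchInnerSum (ν : Stage7Numerics) (τ : TowerNumerics) (E : B12.RunParams → ℝ)
    (w : StepWeightsOfRecord F N ν τ.M) (ppSel : PpSelOfRecord F ν τ.M) (p : B12.RunParams) (g : ℕ → ℝ) {k : ℕ} (hkK : k < p.K)
    {hdec : DecidableEq (PBond (F.P p.K) k)} {hdec' : DecidableEq (PBond (F.P p.K) (k + 1))} (hk : k + 1 ≤ (F.P p.K).m + (F.P p.K).K)
    (s' : SeqOfRecord F ν τ.M g p.K (k + 1)) (W₀ W : TkWeights F N V p.K)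
    (Φ₀ Φ : SFluct (F.P p.K) V → B15DeterminingSets.MSField (F.P p.K) (SU N) → ℝ)
    (hform : ∀ᵐ U ∂fieldMeasure (F.P p.K) k (SU N), chiSeqOfRecord F N ν τ.M g p.K k s'.init U ≠ 0 →
      slotsOfRecord F N ν τ E w ppSel p g k s'.init U = TkOfRecord F N V ν τ.M g p.K W₀ k s'.init Φ₀ U)
    (hG₀ : ∀ S₀ ∈ admSOfRecord F ν τ.M g p.K k s'.init, Integrable (fun U => w p g k s' U ((avOfRecord F N p.K k).avg U) *
      (chiSeqOfRecord F N ν τ.M g p.K k s'.init U *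
        tkBranchOfRecord F N V ν τ.M g p.K W₀ s'.init S₀ k (fun ω => Φ₀ (S₀, fun j => (ω j).2) (fun j => (ω j).1)) (baseCfg k U)))
      (fieldMeasure (F.P p.K) k (SU N)))
    (Fᵢ₀ : (ℕ → Set (Site (F.P p.K) 0)) → (↥(Set.toFinite (bondsIn k (s'.Ω (k + 1))ᶜ)).toFinset → SU N) ×
        ({c : PBond (F.P p.K) (k + 1) // c ∉ (Set.toFinite (bondsIn (k + 1) (s'.Ω (k + 1))ᶜ)).toFinset} → SU N) → ℝ)
    (hFm₀ : ∀ S₀ ∈ admSOfRecord F ν τ.M g p.K k s'.init, Measurable (Fᵢ₀ S₀))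
    (hin₀ : ∀ S₀ ∈ admSOfRecord F ν τ.M g p.K k s'.init, kernelTransport
        ((Measure.pi fun _ : ↥(Set.toFinite (bondsIn k (s'.Ω (k + 1))ᶜ)).toFinset => (HaarData.haar : Measure (SU N))).prod
          (Measure.pi fun _ : {b : PBond (F.P p.K) k // b ∉ (Set.toFinite (bondsIn k (s'.Ω (k + 1))ᶜ)).toFinset} => (HaarData.haar : Measure (SU N))))
        ((Measure.pi fun _ : ↥(Set.toFinite (bondsIn k (s'.Ω (k + 1))ᶜ)).toFinset => (HaarData.haar : Measure (SU N))).prod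
          (Measure.pi fun _ : {c : PBond (F.P p.K) (k + 1) // c ∉ (Set.toFinite (bondsIn (k + 1) (s'.Ω (k + 1))ᶜ)).toFinset} =>
            (HaarData.haar : Measure (SU N))))
        (fun q => (q.1, fun c : {c : PBond (F.P p.K) (k + 1) // c ∉ (Set.toFinite (bondsIn (k + 1) (s'.Ω (k + 1))ᶜ)).toFinset} =>
          (avOfRecord F N p.K k).avg
            ((MeasurableEquiv.piEquivPiSubtypeProd (fun _ : PBond (F.P p.K) k => SU N)
              (· ∈ (Set.toFinite (bondsIn k (s'.Ω (k + 1))ᶜ)).toFinset)).symm q) c))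
        ((fun U => w p g k s' U ((avOfRecord F N p.K k).avg U) *
            (chiSeqOfRecord F N ν τ.M g p.K k s'.init U *
              tkBranchOfRecord F N V ν τ.M g p.K W₀ s'.init S₀ k (fun ω => Φ₀ (S₀, fun j => (ω j).2) (fun j => (ω j).1)) (baseCfg k U))) ∘
          ⇑(MeasurableEquiv.piEquivPiSubtypeProd (fun _ : PBond (F.P p.K) k => SU N)
            (· ∈ (Set.toFinite (bondsIn k (s'.Ω (k + 1))ᶜ)).toFinset)).symm)
      =ᵐ[((Measure.pi fun _ : ↥(Set.toFinite (bondsIn k (s'.Ω (k + 1))ᶜ)).toFinset => (HaarData.haar : Measure (SU N))).prod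
          (Measure.pi fun _ : {c : PBond (F.P p.K) (k + 1) // c ∉ (Set.toFinite (bondsIn (k + 1) (s'.Ω (k + 1))ᶜ)).toFinset} =>
            (HaarData.haar : Measure (SU N))))] Fᵢ₀ S₀)
    (hint : ∀ᵐ q ∂((Measure.pi fun _ : ↥(Set.toFinite (bondsIn (k + 1) (s'.Ω (k + 1))ᶜ)).toFinset => (HaarData.haar : Measure (SU N))).prod
          (Measure.pi fun _ : {c : PBond (F.P p.K) (k + 1) // c ∉ (Set.toFinite (bondsIn (k + 1) (s'.Ω (k + 1))ᶜ)).toFinset} =>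
            (HaarData.haar : Measure (SU N)))),
      ∀ S ∈ admSOfRecord F ν τ.M g p.K (k + 1) s', Integrable
        (fun y : ↥(Set.toFinite (bondsIn k (s'.Ω (k + 1))ᶜ)).toFinset → SU N =>
          zetaOp (genDataOfRecord F N V ν τ.M g p.K W s' S k).ζ
            (aOp k (genDataOfRecord F N V ν τ.M g p.K W s' S k).sA (genDataOfRecord F N V ν τ.M g p.K W s' S k).w
              (tkBranchOfRecord F N V ν τ.M g p.K W s' S k (fun ω => Φ (S, fun j => (ω j).2) (fun j => (ω j).1))))
            (Function.update (baseCfg (k + 1) ((MeasurableEquiv.piEquivPiSubtypeProd (fun _ : PBond (F.P p.K) (k + 1) => SU N)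
                (· ∈ (Set.toFinite (bondsIn (k + 1) (s'.Ω (k + 1))ᶜ)).toFinset)).symm q)) k
              (Function.updateFinset ((baseCfg (V := V) (k + 1) ((MeasurableEquiv.piEquivPiSubtypeProd (fun _ : PBond (F.P p.K) (k + 1) => SU N)
                (· ∈ (Set.toFinite (bondsIn (k + 1) (s'.Ω (k + 1))ᶜ)).toFinset)).symm q)) k).1 (Set.toFinite (bondsIn k (s'.Ω (k + 1))ᶜ)).toFinset y,
                ((baseCfg (V := V) (k + 1) ((MeasurableEquiv.piEquivPiSubtypeProd (fun _ : PBond (F.P p.K) (k + 1) => SU N)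
                (· ∈ (Set.toFinite (bondsIn (k + 1) (s'.Ω (k + 1))ᶜ)).toFinset)).symm q)) k).2)))
        (condLaw (Measure.pi fun _ : ↥(Set.toFinite (bondsIn k (s'.Ω (k + 1))ᶜ)).toFinset => (HaarData.haar : Measure (SU N)))
          (avgRestrOfRecord F N p.K k (Set.toFinite (bondsIn k (s'.Ω (k + 1))ᶜ)).toFinset (Set.toFinite (bondsIn (k + 1) (s'.Ω (k + 1))ᶜ)).toFinset) q.1))
    (hinner₀ : ∀ᵐ q ∂((Measure.pi fun _ : ↥(Set.toFinite (bondsIn (k + 1) (s'.Ω (k + 1))ᶜ)).toFinset => (HaarData.haar : Measure (SU N))).prod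
          (Measure.pi fun _ : {c : PBond (F.P p.K) (k + 1) // c ∉ (Set.toFinite (bondsIn (k + 1) (s'.Ω (k + 1))ᶜ)).toFinset} =>
            (HaarData.haar : Measure (SU N)))),
      ∀ S₀ ∈ admSOfRecord F ν τ.M g p.K k s'.init, ∀ y : ↥(Set.toFinite (bondsIn k (s'.Ω (k + 1))ᶜ)).toFinset → SU N,
        avgRestrOfRecord F N p.K k (Set.toFinite (bondsIn k (s'.Ω (k + 1))ᶜ)).toFinset (Set.toFinite (bondsIn (k + 1) (s'.Ω (k + 1))ᶜ)).toFinset y = q.1 →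
        Fᵢ₀ S₀ (y, q.2) =
          ∑ Y ∈ (Set.toFinite {Y : Set (Site (F.P p.K) 0) | Y ∈ SClassOfRecord F ν g p.K (k + 1) ∧ Y ⊆ s'.Ω (k + 1) ∩ (s'.Λ (k + 1))ᶜ}).toFinset,
            zetaOp (genDataOfRecord F N V ν τ.M g p.K W s' (Function.update S₀ (k + 1) Y) k).ζ
              (aOp k (genDataOfRecord F N V ν τ.M g p.K W s' (Function.update S₀ (k + 1) Y) k).sA
                (genDataOfRecord F N V ν τ.M g p.K W s' (Function.update S₀ (k + 1) Y) k).w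
                (tkBranchOfRecord F N V ν τ.M g p.K W s'.init S₀ k
                  (fun ω => Φ (Function.update S₀ (k + 1) Y, fun j => (ω j).2) (fun j => (ω j).1))))
              (Function.update (baseCfg (k + 1) ((MeasurableEquiv.piEquivPiSubtypeProd (fun _ : PBond (F.P p.K) (k + 1) => SU N)
                (· ∈ (Set.toFinite (bondsIn (k + 1) (s'.Ω (k + 1))ᶜ)).toFinset)).symm q)) k
              (Function.updateFinset ((baseCfg (V := V) (k + 1) ((MeasurableEquiv.piEquivPiSubtypeProd (fun _ : PBond (F.P p.K) (k + 1) => SU N)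
                (· ∈ (Set.toFinite (bondsIn (k + 1) (s'.Ω (k + 1))ᶜ)).toFinset)).symm q)) k).1 (Set.toFinite (bondsIn k (s'.Ω (k + 1))ᶜ)).toFinset y,
                ((baseCfg (V := V) (k + 1) ((MeasurableEquiv.piEquivPiSubtypeProd (fun _ : PBond (F.P p.K) (k + 1) => SU N)
                (· ∈ (Set.toFinite (bondsIn (k + 1) (s'.Ω (k + 1))ᶜ)).toFinset)).symm q)) k).2))) :
    slotsTOfRecord F N ν τ E w ppSel p g (k + 1) s' =ᵐ[fieldMeasure (F.P p.K) (k + 1) (SU N)] TkOfRecord F N V ν τ.M g p.K W (k + 1) s' Φ := by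
  exact slotsTOfRecord_succ_ae_eq_TkOfRecord_succ_of_innerSum ν τ E w ppSel p g hkK (hdec := hdec) (hdec' := hdec') hk s' W Φ
    ((integrable_finsetSum _ hG₀).congr (graph_ae_eq_sum_oldBranch_pieces ν τ E w ppSel p g s' W₀ Φ₀ hform).symm)
    (Finset.measurable_sum _ hFm₀)
    (innerReading_of_oldBranch_pieces ν τ E w ppSel p g (hdec := hdec) (hdec' := hdec') hk s' W₀ Φ₀ hform hG₀ Fᵢ₀ hin₀) hint
    (innerSum_of_oldBranch_identifications ν τ p g (hdec := hdec) (hdec' := hdec') s' W Φ Fᵢ₀ hinner₀)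

end OldBranch

end Summit.QuantumFields.YangMills.Theorems.BalabanUVNodesN11TStepOldBranchInnerSum

end
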